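import Summits.QuantumFields.YangMills.Theorems.BalabanUVNodesN18AtRateRecord13RunTowersGenBelow
import Summits.QuantumFields.YangMills.Theorems.BalabanUVNodesN18AtReadingOfRecord13Sep

/-!
# ⁗ (SEPARATION-GUARD) EDITION of `BalabanUVNodesN18AtRateRecord13RunTowersGenBelow` (p?18g) — seat pub-ymgap-dag-n18-d (N18 = NE5, strategy s2), RE-KEYED on def-T's `Stage13Params.Provisos₁₃Sep` ∕
# `Node00.datumOfRecord₁₃Sep` (`Node00/Record13` v1.2, p501191), RR-2's datum key `Node00.IsDatumOfRecord₁₃CSep` (`Node00/Record13DatumKeySep`, p502881) and dag-n22-e's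
# (T-RATE) layer-B ⁗ homes (`RateReading₁₃Sep`, `RRec₁₃Sep`, `RRec₁₃SepOn`, `readingOfRecord₁₃Sep`, `s_N18_rRec₁₃Sep(On)_iff`, `forall_datumKey₁₃Sep_of_forall_admissible`, `readingOfRecord₁₃Sep_u3`)
#
# WHY (route `route-QuantumFields-BalabanUVNodes` rev 18∕19; director-ym №136–№140, plan g67 KEY-18, dag-lead WORDS-139∕140): print ([Balaban1989LargeFieldII] Thm 1) gives the
# background row only at SEPARATED (2.18)-sequences; def-T ADDED the print-faithful proviso `Provisos₁₃Sep` (deprecate-and-add), the four cruxes were re-minted over it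
# (K3⁗ `SpineGivenEndpointR13Sep` = stmt-QuantumFields-20292), and a theorem binding the OLD proviso cannot be fed from the weaker new one — so every storey typed
# `∀ θ (hP : θ.Provisos₁₃ F N), …` is re-keyed ONCE.  THIS FILE is the twin of this seat's own ‴ module under the token map `Provisos₁₃ ↦ Provisos₁₃Sep` ·
# `datumOfRecord₁₃ ↦ datumOfRecord₁₃Sep` · `IsDatumOfRecord₁₃C ↦ IsDatumOfRecord₁₃CSep` · `RateReading₁₃ ↦ RateReading₁₃Sep` · `RRec₁₃ ↦ RRec₁₃Sep` · `RRec₁₃On ↦ RRec₁₃SepOn` ·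
# `readingOfRecord₁₃ ↦ readingOfRecord₁₃Sep` · `s_N18_rRec₁₃(On)_iff ↦ s_N18_rRec₁₃Sep(On)_iff` · `forall_datumKey₁₃_of_forall_admissible ↦ forall_datumKey₁₃Sep_of_forall_admissible`, and in
# THIS seat's decl names `rRec₁₃ ↦ rRec₁₃Sep`, `readingOfRecord₁₃ ↦ readingOfRecord₁₃Sep`; statements = the ‴ statements under the map, proofs = the ‴ proofs VERBATIM.
# EVERYTHING θ-LEVEL IS UNCHANGED AND NOT RE-DECLARED (`Stage13Params`, `u3OfRecord₁₃`, the per-tuple faces and junctions of the original carry no proviso ∕ key and are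
# IMPORTED BY NAME — this module imports its ‴ original) — here: `hLayer_runTowers_toClusterTower_of_stepGen_lt`, `n18At_u3OfRecord₁₃_readingAdm_runTowers_toClusterTower_of_stepGen_lt`.
# ITEM IDS quoted in the ‴ header below (K3‴ `SpineGivenEndpointR13`, stmt-QuantumFields-19912; K0‴) are ASIDES after rev 18; this file is filed
# `--kind proof --supports stmt-QuantumFields-20292 --as helper` — COUNT-NEUTRAL, no stub closed, N18 NOT discharged, no inhabitant of any ⁗ key claimed (K0⁗ `Record13SepInhabited` OPEN).
#
# ‴ HEADER OF RECORD FOLLOWS (token-mapped; its decl list is this file's, the θ-only names above excepted):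
#
# BalabanUVNodes ∕ node N18 = NE5 — N18 AT THE STAGE-13 HOMES FOR THE GENERATED RUN TOWERS, THE PER-GENERATOR SCHEMA (GEN) ASKED BELOW THE RUN LENGTH ONLY:
# steps `m < k` for run A's generator `G k`, steps `m < k + 1` for run B's generator `G (k+1)` — per tuple and run length, unguarded and at the regime-restricted home
# (Track A, DAG node N18 = `T4OutputRate.NE5` :211; cluster K4 «SpineRates», item K3⁗ `SpineGivenEndpointR13Sep` ∕ K3‴; module 18g of seat pub-ymgap-dag-n18-d, strategy s2)

HONEST FRAMING.  Count-neutral kernel bookkeeping (`--supports … --as helper`), composition BY NAME of landed theorems; NE5 is NOT PRINTED and NOT proved;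
N18 is NOT discharged; no inhabitant of `IsDatumOfRecord₁₃CSep` is claimed (K0 OPEN); the generators `G`, THE END's data and the schema (GEN) are
PARAMETERS ∕ HYPOTHESES.

WHY.  Module 18e (`…N18AtRateRecord13RunTowersGen`, p503555) knitted N18 at the Stage-13 homes for the GENERATED RUN TOWERS `runTowers (k ↦ toClusterTower (G F θ k))`
— the tower family dag-n27-c's XLII and dag-n22-e's 8b″ read — from THE END's data + dag-n18-c's per-generator schema (GEN), with (GEN) asked at EVERY step of the
generators `G k`, `G (k+1)` (the binder of dag-n18-c's producer `hLayer_toClusterTower_of_stepGen`).  But the run of `k` steps on the `k`-th torus performs the steps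
`m = 0, …, k − 1` only ([I] (0.23)–(0.24): «E_k = Σ_{j=1}^{k} E^{(j)}»; W1's `runTowers S k := truncRun k (S k)`): the schema instances at steps `m ≥ k` concern terms the run
never creates, on blocks that outgrow the torus — inputs NODE A is never asked to supply in print, and which a generator of record need not satisfy (cf. dag-lead's
LOCATED-C2-RUNS on torus-wrapping runs).  THIS FILE removes them: (GEN) for `G k` is asked at the steps `m < k` and for `G (k+1)` at the steps `m < k + 1` ONLY —
dag-n22-e 8b″'s `m < k` indexation for the N22 schemas on the same generators.  The device (§1): dag-n18-c's producer run on the table family CUT AT THE RUN LENGTH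
(`sp j` for `j ≤ K`, the EMPTY table beyond, where (GEN) and the restriction property hold outright), read back below the run length by W1's eliminator `truncRun_cases`,
the termless steps beyond by `analyticH_termlessTower` ∕ `bound238_termlessTower`; then module 18 §1's junction at `S := runTowers (k ↦ toClusterTower (G k))` (§2) and the
family rows (§3), VERBATIM module 18e's but for the two step binders.

WHAT (all `theorem`, 0 `def`).
* §1 `hLayer_runTowers_toClusterTower_of_stepGen_lt` (the run tower's (2.38) pair at every level from (GEN) below the run length).
* §2 ★ `n18At_u3OfRecord₁₃_readingAdm_runTowers_toClusterTower_of_stepGen_lt` (ONE tuple, ONE run length; hypothesis = module 18e §2's with `∀ m < k` ∕ `∀ m < k + 1`).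
* §3 ★ `s_N18_rRec₁₃Sep_readingAdm_runTowers_toClusterTower_of_stepGen_lt_pin` (unguarded home), ★ `s_N18_rRec₁₃SepOn_readingAdm_runTowers_toClusterTower_of_stepGen_lt_pin`
  (regime home).

One finite four-torus programme at fixed `ε`; NOT the continuum limit, NOT OS, NOT a mass gap, NOT Clay.  0 `def`, 0 `sorry`.  Sources (TYPES only): T. Bałaban,
CMP **109** (1987) [Balaban1987RG1] (0.23)–(0.25) pp. 256–257, Thm 1 p. 259, (1.18) p. 263, (2.12)–(2.13) p. 268; CMP **116** (1988) [Balaban1988RG2Cluster] (1.41)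
p. 11, (2.13)–(2.14) pp. 14–15, Lemma 3 (2.38) p. 20; CMP **122** (1989) [Balaban1989LargeFieldII] (the record's stage).
-/

noncomputable section

open Set Metric
open scoped Matrix.Norms.L2Operator

namespace YMDAG.N18.W1Reading

open Literature.MathematicalPhysics.QuantumFieldTheory.Balaban1983to89
open Literature.MathematicalPhysics.QuantumFieldTheory.Balaban1983to89.T4Continuum
open Literature.MathematicalPhysics.QuantumFieldTheory.Balaban1983to89.T4OutputRate (Carriers Functional NE5 DecayBound Window)
open Literature.MathematicalPhysics.QuantumFieldTheory.Balaban1983to89.T4InputCauchyRateData (StepModel)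
open Literature.MathematicalPhysics.QuantumFieldTheory.Balaban1983to89.B13Resummation (locE)
open Literature.MathematicalPhysics.QuantumFieldTheory.Balaban1983to89.TreeLengthTorus (TDom tsys torusTreeLen)
open Literature.MathematicalPhysics.QuantumFieldTheory.Balaban1983to89.TreeLengthTorusGeometry (TTouch)
open Literature.MathematicalPhysics.QuantumFieldTheory.Balaban1983to89.B12TreeDecay (K₀)
open Literature.MathematicalPhysics.QuantumFieldTheory.Balaban1983to89.Node00 (Stage12Params Stage13Params IsDatumOfRecord₁₃CSep datumOfRecord₁₃Sep U3Letters₁₁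
  U3Objects₁₁ NE2Objects₁₁ NE3Letters₁₁ prependCoupling MatA ιSU avOfRecord)
open Literature.MathematicalPhysics.QuantumFieldTheory.Balaban1983to89.Node00.Sect2 (domCount domSys CPair ofBackgroundC)
open Literature.MathematicalPhysics.QuantumFieldTheory.Balaban1983to89.Node00.W1 (ReadingData LevelPairing LetterInputs ClusterTower ClusterStep pairOfRecord
  dj_pairOfRecord functionalC functional termC box SpRestr AdmBg GenTower OlderTerms toClusterTower truncRun runTowers termlessTower truncRun_cases
  functionalC_truncRun_of_le functionalC_truncRun_eq_zero)
open Summit.QuantumFields.BalabanUV.T4Continuum.B13Carriers (transportRaw)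
open Summit.QuantumFields.BalabanUV.T4Continuum.Spine.NE5
open Summit.QuantumFields.YangMills.BalabanUVNodes.N18HLayerW1Config (analyticH_termlessTower bound238_termlessTower)
open Summit.QuantumFields.YangMills.BalabanUVNodes.N18HLayerW1Recursion (hLayer_toClusterTower_of_stepGen)
open YMDAG.N18.HLayer
open YMDAG.UVSplit

variable {N : ℕ} [NeZero N]

/-! ## §3 The family rows at the Stage-13 homes for generated run towers -/

section Record

variable (𝔯 : RateReading₁₃Sep N) (Rg : (F : T4Family) → Stage13Params F N → Prop)
  (G : (F : T4Family) → (θ : Stage13Params F N) → (k : ℕ) → GenTower (F.P k) (MatA N) θ.τ9.M)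
  (D : (F : T4Family) → Stage13Params F N → ℕ → Set ℂ)
  (sp : (F : T4Family) → (θ : Stage13Params F N) → (k j : ℕ) → (domSys (F.P k) θ.τ9.M j).Dom → Set (CPair (F.P k) (MatA N)))
  (gauge : (F : T4Family) → (θ : Stage13Params F N) → (k : ℕ) → GaugeField (F.P k) 0 (Node00.SU N) → GaugeField (F.P k) 0 (Node00.SU N) → ℝ)
  (hg : ∀ (F : T4Family) (θ : Stage13Params F N) (k : ℕ) (U U' : GaugeField (F.P k) 0 (Node00.SU N)), 0 ≤ gauge F θ k U U')
  (T₀ : (F : T4Family) → (θ : Stage13Params F N) → (k : ℕ) → GaugeField (F.P (k + 1)) 0 (Node00.SU N) → GaugeField (F.P k) 0 (Node00.SU N))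
  (hT : ∀ (F : T4Family) (θ : Stage13Params F N) (k : ℕ) (U : GaugeField (F.P (k + 1)) 0 (Node00.SU N)),
    (∀ (j : ℕ) (Y : (domSys (F.P (k + 1)) θ.τ9.M j).Dom), ofBackgroundC (ιSU N) U ∈ sp F θ (k + 1) j Y) →
      ∀ (j : ℕ) (X : (domSys (F.P k) θ.τ9.M j).Dom), ofBackgroundC (ιSU N) (T₀ F θ k U) ∈ sp F θ k j X)
  (li : (F : T4Family) → Stage13Params F N → LetterInputs)
  (hpin : ∀ (F : T4Family) (θ : Stage13Params F N) (hP : θ.Provisos₁₃Sep F N) (g₀ : ℕ → ℝ) (os : List (ULoop F)),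
    (𝔯.lit F θ hP g₀ os).u3 =
      (ReadingData.ofRecordAdm F θ.τ9.M N (runTowers fun k => toClusterTower (G F θ k)) (sp F θ) (gauge F θ) (hg F θ) (T₀ F θ) (hT F θ) (li F θ)).u3Objects θ.γ)

include hpin in
open Classical in
/-- ★ **THE (GEN)-BELOW-THE-RUN-LENGTH ROW AT THE STAGE-13 HOME FOR THE GENERATED RUN TOWERS** [bookkeeping; §2 at every admissible Stage-13 tuple with provisos and every run length,
module 18's `s_N18_rRec₁₃Sep_of_forall_admissible_pin`]: for a reading pinned to the admissible reading family whose towers are the GENERATED RUN TOWERS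
`runTowers (k ↦ toClusterTower (G F θ k))` (tables `sp F θ`, transports `T₀ F θ` with clause `hT`, letters `li F θ`, coupling domains `D F θ k`): if at EVERY admissible
Stage-13 tuple `θ` with `Provisos₁₃Sep` and every run length `k` there are (i) THE END's data over the carriers of the admissible level pairing (functionals of the run
towers) and (ii) (GEN) for both runs' generators on their tables BELOW THE RUN LENGTHS (`m < k` ∕ `m < k + 1`) with the STRICT clauses, renewals and
`]0, γ′] ⊆ D F θ k`, the letters dominating — then `S_N18 (RRec₁₃Sep 𝔯)`.  Module 18e's row with the bounded step binders. [cite: Balaban1987RG1, (0.23)–(0.25) pp.256–257, Thm 1 p.259, (1.18) p.263 and (2.12)–(2.13) p.268;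
Balaban1988RG2Cluster, (1.41) p.11, (2.13)–(2.14) pp.14–15, Lemma 3 (2.38) p.20] -/
theorem s_N18_rRec₁₃Sep_readingAdm_runTowers_toClusterTower_of_stepGen_lt_pin
    (h : ∀ (F : T4Family) (θ : Stage13Params F N), θ.Provisos₁₃Sep F N → θ.Admissible F N → ∀ k : ℕ,
      ∃ (Op : Type) (_ : NormedAddCommGroup Op) (_ : NormedSpace ℂ Op) (Hist : Type) (_ : NormedAddCommGroup Hist) (_ : NormedSpace ℂ Hist)
        (Mb : ℝ → StepModel (LevelPairing.ofRecordAdm F θ.τ9.M N k (sp F θ) (gauge F θ k) (hg F θ k) (T₀ F θ k) (hT F θ k)).carriers Op Hist)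
        (act : ℝ → (j : ℕ) → Op × Hist → TDom 4 (domCount (F.P k) θ.τ9.M j) → ℂ) (γ' C3 ε₁ Rd κ A_A A_B E_A E_B E₁ δ δ' θr θ' cH ω ρ₀ B : ℝ)
        (k₀ : ℕ),
        (∀ b : ℝ, 0 < b → b ≤ γ' → ∀ (X : Node00.W1.Dom (F.P k) θ.τ9.M) (z : Op × Hist),
          (Mb b).Out X.1 z.1 z.2 X =
            locE (TTouch (d := 4) (N := domCount (F.P k) θ.τ9.M X.1)) (fun Z : (tsys 4 (domCount (F.P k) θ.τ9.M X.1)).Dom => Z.1)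
              (act b X.1 z) X.2.1) ∧
        0 ≤ C3 ∧ 0 ≤ ε₁ ∧ 0 ≤ κ ∧ κ + 2 * (64 * Real.log 162) + 2 ≤ Rd ∧
        C3 * ε₁ * Real.exp (5 * κ + 1) * K₀ 64 8 * 9 * 64 ≤ 1 ∧
        (∀ b : ℝ, 0 < b → b ≤ γ' → ∀ j, ∀ g ∈ Window γ',
          ∀ (U : (LevelPairing.ofRecordAdm F θ.τ9.M N k (sp F θ) (gauge F θ k) (hg F θ k) (T₀ F θ k) (hT F θ k)).BgB) (q : Op × Hist),
          q ∈ (Mb b).Base j g U →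
          ∃ V : Set (Op × Hist), IsOpen V ∧ (Mb b).box j q ⊆ V ∧
            (∀ Z : TDom 4 (domCount (F.P k) θ.τ9.M j), DifferentiableOn ℂ (fun z : Op × Hist => act b j z Z) V) ∧
            (∀ z ∈ V, ∀ Z : TDom 4 (domCount (F.P k) θ.τ9.M j), ‖act b j z Z‖ ≤ C3 * ε₁ * Real.exp (-(Rd * torusTreeLen Z.1)))) ∧
        (∀ b : ℝ, 0 < b → b ≤ γ' → L01 (Mb b)
          ((LevelPairing.ofRecordAdm F θ.τ9.M N k (sp F θ) (gauge F θ k) (hg F θ k) (T₀ F θ k) (hT F θ k)).EA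
            (runTowers (fun k => toClusterTower (G F θ k)) k)) (Window γ')) ∧
        (∀ b : ℝ, 0 < b → b ≤ γ' → L02 (Mb b)
          ((LevelPairing.ofRecordAdm F θ.τ9.M N k (sp F θ) (gauge F θ k) (hg F θ k) (T₀ F θ k) (hT F θ k)).EB
            (runTowers (fun k => toClusterTower (G F θ k)) (k + 1)) b) (Window γ')) ∧
        (∀ b : ℝ, 0 < b → b ≤ γ' → L03 (Mb b)
          ((LevelPairing.ofRecordAdm F θ.τ9.M N k (sp F θ) (gauge F θ k) (hg F θ k) (T₀ F θ k) (hT F θ k)).EB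
            (runTowers (fun k => toClusterTower (G F θ k)) (k + 1)) b) (Window γ')) ∧
        (∀ b : ℝ, 0 < b → b ≤ γ' → L07 (Mb b) (Window γ') δ θr) ∧
        (∀ b : ℝ, 0 < b → b ≤ γ' → L08 (Mb b) (Window γ') κ (Real.exp 1 * 9 * 64 * K₀ 64 8 ^ 2 * A_B) δ' θr) ∧
        (∀ b : ℝ, 0 < b → b ≤ γ' → L09aff (Mb b) (Window γ')) ∧ (∀ b : ℝ, 0 < b → b ≤ γ' → L09blind (Mb b) (Window γ')) ∧
        (∀ b : ℝ, 0 < b → b ≤ γ' → L09hom (Mb b) (Window γ')) ∧ (∀ b : ℝ, 0 < b → b ≤ γ' → L09unit (Mb b) (Window γ') κ E₁ cH ω) ∧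
        0 < E₁ ∧ 0 ≤ δ + δ' ∧ 0 ≤ θr ∧ θr ≤ θ' ∧ θ' ≤ 1 ∧ 0 ≤ cH ∧ 0 < ω ∧ ρ₀ < 1 ∧
        (δ + δ') * θr ^ k₀ +
            cH * (Real.exp 1 * 9 * 64 * K₀ 64 8 ^ 2 * A_A + Real.exp 1 * 9 * 64 * K₀ 64 8 ^ 2 * A_B) / (1 - ω) ≤ ρ₀ ∧
        0 ≤ B ∧ (∀ k < k₀, Real.exp 1 * 9 * 64 * K₀ 64 8 ^ 2 * A_A + Real.exp 1 * 9 * 64 * K₀ 64 8 ^ 2 * A_B ≤ B * θr ^ k) ∧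
        Real.exp 1 * 9 * 64 * K₀ 64 8 ^ 2 * C3 * cH * ε₁ < (θ' - ω) * (1 - ρ₀) ∧
        (∀ m, SpRestr (sp F θ k (m + 1))) ∧
        (∀ m < k, ∀ t ∈ D F θ k, ∀ old : OlderTerms (F.P k) (MatA N) θ.τ9.M m,
          (∀ (j : Fin (m + 1)) (Y : (domSys (F.P k) θ.τ9.M j).Dom), ∀ ψ ∈ sp F θ k j Y,
              ‖old j Y ψ‖ ≤ E_A * Real.exp (-(κ * (domSys (F.P k) θ.τ9.M j).dj Y))) →
          (∀ (j : Fin (m + 1)) (Y : (domSys (F.P k) θ.τ9.M j).Dom), AnalyticOnNhd ℂ (old j Y) (sp F θ k j Y)) →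
          (∀ Z : (domSys (F.P k) θ.τ9.M (m + 1)).Dom, AnalyticOnNhd ℂ (fun φ => (G F θ k m).H t old φ Z) (sp F θ k (m + 1) Z)) ∧
          (∀ (Z : (domSys (F.P k) θ.τ9.M (m + 1)).Dom), ∀ φ ∈ sp F θ k (m + 1) Z,
              ‖(G F θ k m).H t old φ Z‖ ≤ A_A * Real.exp (-(Rd * (domSys (F.P k) θ.τ9.M (m + 1)).dj Z)))) ∧
        0 ≤ A_A ∧ A_A * Real.exp (5 * κ + 1) * K₀ 64 8 * 9 * 64 < 1 ∧ Real.exp 1 * 9 * 64 * K₀ 64 8 ^ 2 * A_A ≤ E_A ∧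
        (∀ m, SpRestr (sp F θ (k + 1) (m + 1))) ∧
        (∀ m < k + 1, ∀ t ∈ D F θ k, ∀ old : OlderTerms (F.P (k + 1)) (MatA N) θ.τ9.M m,
          (∀ (j : Fin (m + 1)) (Y : (domSys (F.P (k + 1)) θ.τ9.M j).Dom), ∀ ψ ∈ sp F θ (k + 1) j Y,
              ‖old j Y ψ‖ ≤ E_B * Real.exp (-(κ * (domSys (F.P (k + 1)) θ.τ9.M j).dj Y))) →
          (∀ (j : Fin (m + 1)) (Y : (domSys (F.P (k + 1)) θ.τ9.M j).Dom), AnalyticOnNhd ℂ (old j Y) (sp F θ (k + 1) j Y)) →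
          (∀ Z : (domSys (F.P (k + 1)) θ.τ9.M (m + 1)).Dom, AnalyticOnNhd ℂ (fun φ => (G F θ (k + 1) m).H t old φ Z) (sp F θ (k + 1) (m + 1) Z)) ∧
          (∀ (Z : (domSys (F.P (k + 1)) θ.τ9.M (m + 1)).Dom), ∀ φ ∈ sp F θ (k + 1) (m + 1) Z,
              ‖(G F θ (k + 1) m).H t old φ Z‖ ≤ A_B * Real.exp (-(Rd * (domSys (F.P (k + 1)) θ.τ9.M (m + 1)).dj Z)))) ∧
        0 ≤ A_B ∧ A_B * Real.exp (5 * κ + 1) * K₀ 64 8 * 9 * 64 < 1 ∧ Real.exp 1 * 9 * 64 * K₀ 64 8 ^ 2 * A_B ≤ E_B ∧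
        (∀ s ∈ Ioc (0 : ℝ) γ', ((s : ℝ) : ℂ) ∈ D F θ k) ∧
        θ.γ ≤ γ' ∧ (li F θ).κ ≤ κ ∧ θ' ≤ (li F θ).θ₅ ∧
        (Real.exp 1 * 9 * 64 * K₀ 64 8 ^ 2 * (C3 * ε₁) / (1 - ρ₀) * (δ + δ') + B) * (θ' - ω) /
            (θ' - (ω + Real.exp 1 * 9 * 64 * K₀ 64 8 ^ 2 * (C3 * ε₁) / (1 - ρ₀) * cH)) ≤ (li F θ).C₅) :
    S_N18 (RRec₁₃Sep 𝔯) :=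
  s_N18_rRec₁₃Sep_of_forall_admissible_pin 𝔯 _ hpin fun F θ hP hA k =>
    n18At_u3OfRecord₁₃_readingAdm_runTowers_toClusterTower_of_stepGen_lt θ k (G F θ) (D F θ k) (sp F θ) (gauge F θ) (hg F θ) (T₀ F θ) (hT F θ) (li F θ)
      (h F θ hP hA k)

include hpin in
open Classical in
/-- ★ **THE (GEN)-BELOW-THE-RUN-LENGTH ROW FOR THE GENERATED RUN TOWERS AT THE REGIME-RESTRICTED HOME — THE DATA ASKED ONLY OF THE TUPLES IN THE REGIME** [bookkeeping; §2 under the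
guard, layer B's `s_N18_rRec₁₃SepOn_iff`]: the same with (i)–(ii) asked only at the admissible tuples with `Provisos₁₃Sep` IN `Rg` ⟹ `S_N18 (RRec₁₃SepOn 𝔯 Rg)` — rev 16 ∕ 17's
guarded binder at `Rg F θ := θ.ZtUnity F N ∧ θ.SlotsNondegenerate₁₃ F N`. [cite: Balaban1987RG1, (0.23)–(0.25) pp.256–257, Thm 1 p.259 and (1.18) p.263; Balaban1988RG2Cluster, (2.13)–(2.14) pp.14–15 and Lemma 3 (2.38) p.20] -/
theorem s_N18_rRec₁₃SepOn_readingAdm_runTowers_toClusterTower_of_stepGen_lt_pin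
    (h : ∀ (F : T4Family) (θ : Stage13Params F N), θ.Provisos₁₃Sep F N → Rg F θ → θ.Admissible F N → ∀ k : ℕ,
      ∃ (Op : Type) (_ : NormedAddCommGroup Op) (_ : NormedSpace ℂ Op) (Hist : Type) (_ : NormedAddCommGroup Hist) (_ : NormedSpace ℂ Hist)
        (Mb : ℝ → StepModel (LevelPairing.ofRecordAdm F θ.τ9.M N k (sp F θ) (gauge F θ k) (hg F θ k) (T₀ F θ k) (hT F θ k)).carriers Op Hist)
        (act : ℝ → (j : ℕ) → Op × Hist → TDom 4 (domCount (F.P k) θ.τ9.M j) → ℂ) (γ' C3 ε₁ Rd κ A_A A_B E_A E_B E₁ δ δ' θr θ' cH ω ρ₀ B : ℝ)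
        (k₀ : ℕ),
        (∀ b : ℝ, 0 < b → b ≤ γ' → ∀ (X : Node00.W1.Dom (F.P k) θ.τ9.M) (z : Op × Hist),
          (Mb b).Out X.1 z.1 z.2 X =
            locE (TTouch (d := 4) (N := domCount (F.P k) θ.τ9.M X.1)) (fun Z : (tsys 4 (domCount (F.P k) θ.τ9.M X.1)).Dom => Z.1)
              (act b X.1 z) X.2.1) ∧
        0 ≤ C3 ∧ 0 ≤ ε₁ ∧ 0 ≤ κ ∧ κ + 2 * (64 * Real.log 162) + 2 ≤ Rd ∧
        C3 * ε₁ * Real.exp (5 * κ + 1) * K₀ 64 8 * 9 * 64 ≤ 1 ∧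
        (∀ b : ℝ, 0 < b → b ≤ γ' → ∀ j, ∀ g ∈ Window γ',
          ∀ (U : (LevelPairing.ofRecordAdm F θ.τ9.M N k (sp F θ) (gauge F θ k) (hg F θ k) (T₀ F θ k) (hT F θ k)).BgB) (q : Op × Hist),
          q ∈ (Mb b).Base j g U →
          ∃ V : Set (Op × Hist), IsOpen V ∧ (Mb b).box j q ⊆ V ∧
            (∀ Z : TDom 4 (domCount (F.P k) θ.τ9.M j), DifferentiableOn ℂ (fun z : Op × Hist => act b j z Z) V) ∧
            (∀ z ∈ V, ∀ Z : TDom 4 (domCount (F.P k) θ.τ9.M j), ‖act b j z Z‖ ≤ C3 * ε₁ * Real.exp (-(Rd * torusTreeLen Z.1)))) ∧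
        (∀ b : ℝ, 0 < b → b ≤ γ' → L01 (Mb b)
          ((LevelPairing.ofRecordAdm F θ.τ9.M N k (sp F θ) (gauge F θ k) (hg F θ k) (T₀ F θ k) (hT F θ k)).EA
            (runTowers (fun k => toClusterTower (G F θ k)) k)) (Window γ')) ∧
        (∀ b : ℝ, 0 < b → b ≤ γ' → L02 (Mb b)
          ((LevelPairing.ofRecordAdm F θ.τ9.M N k (sp F θ) (gauge F θ k) (hg F θ k) (T₀ F θ k) (hT F θ k)).EB
            (runTowers (fun k => toClusterTower (G F θ k)) (k + 1)) b) (Window γ')) ∧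
        (∀ b : ℝ, 0 < b → b ≤ γ' → L03 (Mb b)
          ((LevelPairing.ofRecordAdm F θ.τ9.M N k (sp F θ) (gauge F θ k) (hg F θ k) (T₀ F θ k) (hT F θ k)).EB
            (runTowers (fun k => toClusterTower (G F θ k)) (k + 1)) b) (Window γ')) ∧
        (∀ b : ℝ, 0 < b → b ≤ γ' → L07 (Mb b) (Window γ') δ θr) ∧
        (∀ b : ℝ, 0 < b → b ≤ γ' → L08 (Mb b) (Window γ') κ (Real.exp 1 * 9 * 64 * K₀ 64 8 ^ 2 * A_B) δ' θr) ∧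
        (∀ b : ℝ, 0 < b → b ≤ γ' → L09aff (Mb b) (Window γ')) ∧ (∀ b : ℝ, 0 < b → b ≤ γ' → L09blind (Mb b) (Window γ')) ∧
        (∀ b : ℝ, 0 < b → b ≤ γ' → L09hom (Mb b) (Window γ')) ∧ (∀ b : ℝ, 0 < b → b ≤ γ' → L09unit (Mb b) (Window γ') κ E₁ cH ω) ∧
        0 < E₁ ∧ 0 ≤ δ + δ' ∧ 0 ≤ θr ∧ θr ≤ θ' ∧ θ' ≤ 1 ∧ 0 ≤ cH ∧ 0 < ω ∧ ρ₀ < 1 ∧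
        (δ + δ') * θr ^ k₀ +
            cH * (Real.exp 1 * 9 * 64 * K₀ 64 8 ^ 2 * A_A + Real.exp 1 * 9 * 64 * K₀ 64 8 ^ 2 * A_B) / (1 - ω) ≤ ρ₀ ∧
        0 ≤ B ∧ (∀ k < k₀, Real.exp 1 * 9 * 64 * K₀ 64 8 ^ 2 * A_A + Real.exp 1 * 9 * 64 * K₀ 64 8 ^ 2 * A_B ≤ B * θr ^ k) ∧
        Real.exp 1 * 9 * 64 * K₀ 64 8 ^ 2 * C3 * cH * ε₁ < (θ' - ω) * (1 - ρ₀) ∧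
        (∀ m, SpRestr (sp F θ k (m + 1))) ∧
        (∀ m < k, ∀ t ∈ D F θ k, ∀ old : OlderTerms (F.P k) (MatA N) θ.τ9.M m,
          (∀ (j : Fin (m + 1)) (Y : (domSys (F.P k) θ.τ9.M j).Dom), ∀ ψ ∈ sp F θ k j Y,
              ‖old j Y ψ‖ ≤ E_A * Real.exp (-(κ * (domSys (F.P k) θ.τ9.M j).dj Y))) →
          (∀ (j : Fin (m + 1)) (Y : (domSys (F.P k) θ.τ9.M j).Dom), AnalyticOnNhd ℂ (old j Y) (sp F θ k j Y)) →
          (∀ Z : (domSys (F.P k) θ.τ9.M (m + 1)).Dom, AnalyticOnNhd ℂ (fun φ => (G F θ k m).H t old φ Z) (sp F θ k (m + 1) Z)) ∧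
          (∀ (Z : (domSys (F.P k) θ.τ9.M (m + 1)).Dom), ∀ φ ∈ sp F θ k (m + 1) Z,
              ‖(G F θ k m).H t old φ Z‖ ≤ A_A * Real.exp (-(Rd * (domSys (F.P k) θ.τ9.M (m + 1)).dj Z)))) ∧
        0 ≤ A_A ∧ A_A * Real.exp (5 * κ + 1) * K₀ 64 8 * 9 * 64 < 1 ∧ Real.exp 1 * 9 * 64 * K₀ 64 8 ^ 2 * A_A ≤ E_A ∧
        (∀ m, SpRestr (sp F θ (k + 1) (m + 1))) ∧
        (∀ m < k + 1, ∀ t ∈ D F θ k, ∀ old : OlderTerms (F.P (k + 1)) (MatA N) θ.τ9.M m,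
          (∀ (j : Fin (m + 1)) (Y : (domSys (F.P (k + 1)) θ.τ9.M j).Dom), ∀ ψ ∈ sp F θ (k + 1) j Y,
              ‖old j Y ψ‖ ≤ E_B * Real.exp (-(κ * (domSys (F.P (k + 1)) θ.τ9.M j).dj Y))) →
          (∀ (j : Fin (m + 1)) (Y : (domSys (F.P (k + 1)) θ.τ9.M j).Dom), AnalyticOnNhd ℂ (old j Y) (sp F θ (k + 1) j Y)) →
          (∀ Z : (domSys (F.P (k + 1)) θ.τ9.M (m + 1)).Dom, AnalyticOnNhd ℂ (fun φ => (G F θ (k + 1) m).H t old φ Z) (sp F θ (k + 1) (m + 1) Z)) ∧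
          (∀ (Z : (domSys (F.P (k + 1)) θ.τ9.M (m + 1)).Dom), ∀ φ ∈ sp F θ (k + 1) (m + 1) Z,
              ‖(G F θ (k + 1) m).H t old φ Z‖ ≤ A_B * Real.exp (-(Rd * (domSys (F.P (k + 1)) θ.τ9.M (m + 1)).dj Z)))) ∧
        0 ≤ A_B ∧ A_B * Real.exp (5 * κ + 1) * K₀ 64 8 * 9 * 64 < 1 ∧ Real.exp 1 * 9 * 64 * K₀ 64 8 ^ 2 * A_B ≤ E_B ∧
        (∀ s ∈ Ioc (0 : ℝ) γ', ((s : ℝ) : ℂ) ∈ D F θ k) ∧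
        θ.γ ≤ γ' ∧ (li F θ).κ ≤ κ ∧ θ' ≤ (li F θ).θ₅ ∧
        (Real.exp 1 * 9 * 64 * K₀ 64 8 ^ 2 * (C3 * ε₁) / (1 - ρ₀) * (δ + δ') + B) * (θ' - ω) /
            (θ' - (ω + Real.exp 1 * 9 * 64 * K₀ 64 8 ^ 2 * (C3 * ε₁) / (1 - ρ₀) * cH)) ≤ (li F θ).C₅) :
    S_N18 (RRec₁₃SepOn 𝔯 Rg) := by
  rw [s_N18_rRec₁₃SepOn_iff]
  intro F θ hP hRg hA g₀ os k
  rw [hpin]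
  exact n18At_u3OfRecord₁₃_readingAdm_runTowers_toClusterTower_of_stepGen_lt θ k (G F θ) (D F θ k) (sp F θ) (gauge F θ) (hg F θ) (T₀ F θ) (hT F θ) (li F θ)
    (h F θ hP hRg hA k)

end Record

end YMDAG.N18.W1Reading

end
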